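import Summits.QuantumAdvantage.QuantumAdvantage.Theorems.NearExactIsExact.Negative.NoCaseATwelve
import Summits.QuantumAdvantage.QuantumAdvantage.Theorems.NearExactIsExact.Negative.TypeOTwelveDigits
import Summits.QuantumAdvantage.QuantumAdvantage.Theorems.CubicForrelationNearExactIsExactBentDuality

/-!
# Crux `CubicForrelation.NearExactIsExact` (stmt-QuantumAdvantage-14043) — n = 12: cubic supports on TRANSLATES of coordinate cubes

Certificate seat `b2b-cforr-cert` (gen 33).  HONEST FRAMING: kernel-checked elementary counting lemmas (standard axioms) about cubic Boolean
functions on 12 bits, used by …TwelveDigitNoPeriod (the digit class of a type-O cubic has no period) in the analysis of the one remaining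
case "E1280-even" of the open window `(57/64, 29/32)` (…TwelveDigitWeightReduction).  Nothing about `θ₁₂`; NOT summit progress.

For a coordinate set `J` and a set `A` of coordinates, the TRANSLATE `1_A ⊕ E_J` of the cube `E_J = {x : supp x ⊆ J}` is
`{y : y_l = [l ∈ A] for l ∉ J}`.
* `tdn_card_bxor_mod2`: `#{f ⊕ h} ≡ #{f} + #{h} (mod 2)`.
* `tdn_flat3_parity`: a cubic `κ` meets every translate of a `3`-cube `E_J` in a number of points of the same parity as `#(κ ∩ E_J)`
  (the derivative `D_aκ`, `a = 1_{A∖J}`, is quadratic — `stub_derivDegree` — hence even on `3`-cubes — Ax with `d = 2`).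
* `tdn_flat_split`, `tdn_flat2_count`: for `|J| = 2` and `I ∩ J = ∅`,
  `#(κ ∩ (1_I ⊕ E_J)) ≡ #(κ ∩ E_J) + Σ_{i ∈ I} #(κ ∩ E_{J ∪ {i}}) (mod 2)` — the coefficient of `y_J` in the algebraic normal form of the
  derivative `D_{1_I}κ` is `Σ_{i ∈ I} c_{J ∪ {i}}` (induction on `I`, splitting a `3`-cube translate into two `2`-cube translates).

References: J. Ax (1964) / R. J. McEliece (1972); C. Carlet (2021) §2.2.  Axioms: the standard three.
-/

set_option linter.dupNamespace false -- D-0017: single-problem summit ⇒ `QuantumAdvantage.QuantumAdvantage` by design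

noncomputable section

namespace Summit.QuantumAdvantage.QuantumAdvantage.Theorems.CubicForrelation.NearExactIsExact

open Finset
open Literature.Computability.QuantumComplexity
open Literature.Computability.QuantumComplexity.BuzetChailloux (bxor zeroVec bxor_bxor_cancel_left bxor_zeroVec zeroVec_bxor bxor_comm
  bxor_self)
open Literature.Computability.QuantumComplexity.DerivativeWalsh (W)
open Summit.QuantumAdvantage.QuantumAdvantage.Theorems.NearExactIsExact.Negative.TypeOTwelve
  (cube_bias_congr card_cube_int digit_two digit_three)

/-! ### Translates of coordinate cubes and cubic supports -/

section Flats

variable (κ : (Fin (6 + 6) → Bool) → Bool)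

/-- Counting the support of an XOR: `#{f ⊕ h} ≡ #{f} + #{h} (mod 2)` on any finite set. -/
theorem tdn_card_bxor_mod2 (s : Finset (Fin (6 + 6) → Bool)) (f h : (Fin (6 + 6) → Bool) → Bool) :
    (#(s.filter fun x => (f x ^^ h x) = true) : ℤ) % 2 = ((#(s.filter fun x => f x = true) : ℤ) + #(s.filter fun x => h x = true)) % 2 := by
  have key : (#(s.filter fun x => (f x ^^ h x) = true) : ℤ) + 2 * #(s.filter fun x => f x = true ∧ h x = true) =
      #(s.filter fun x => f x = true) + #(s.filter fun x => h x = true) := by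
    have e : ∀ x, (if (f x ^^ h x) = true then (1 : ℤ) else 0) + 2 * (if (f x = true ∧ h x = true) then 1 else 0) =
        (if f x = true then 1 else 0) + (if h x = true then 1 else 0) := by
      intro x; cases f x <;> cases h x <;> simp
    have := sum_congr rfl fun x (_ : x ∈ s) => e x
    rw [sum_add_distrib, sum_add_distrib, ← mul_sum, sum_boole, sum_boole, sum_boole, sum_boole] at this
    exact_mod_cast this
  omega

/-- The translate of the coordinate cube `E_J` through the indicator vector of `A`: `y` agrees with `1_A` outside `J`.  For `A = ∅` this
is `E_J` itself. -/
theorem tdn_flat_empty (J : Finset (Fin (6 + 6))) (y : Fin (6 + 6) → Bool) :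
    (∀ l, l ∉ J → y l = decide (l ∈ (∅ : Finset (Fin (6 + 6))))) ↔ (∀ i, y i = true → i ∈ J) := by
  simp only [notMem_empty, decide_false]
  constructor
  · intro h i hi
    by_contra hiJ
    rw [h i hiJ] at hi
    exact Bool.false_ne_true hi
  · intro h l hl
    cases hy : y l
    · rfl
    · exact absurd (h l hy) hl

/-- **Cubic supports meet all translates of a `3`-cube with the same parity.**  For cubic `κ` on 12 bits, `|J| = 3` and any `A`:
`#{y ∈ 1_A ⊕ E_J : κ y} ≡ #{x ∈ E_J : κ x} (mod 2)` — the derivative `D_aκ` (`a = 1_{A∖J}`) is quadratic and has even weight on the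
`3`-cube `E_J` (Ax with `d = 2`). [this work] -/
theorem tdn_flat3_parity (hκ : IsDegLeFun 3 κ) (J : Finset (Fin (6 + 6))) (hJ : #J = 3) (A : Finset (Fin (6 + 6))) :
    (#(univ.filter fun y : Fin (6 + 6) → Bool => (∀ l, l ∉ J → y l = decide (l ∈ A)) ∧ κ y = true) : ℤ) % 2 =
      (#(univ.filter fun x : Fin (6 + 6) → Bool => (∀ i, x i = true → i ∈ J) ∧ κ x = true) : ℤ) % 2 := by
  -- the translation vector
  set a : Fin (6 + 6) → Bool := fun l => decide (l ∈ A ∧ l ∉ J) with ha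
  -- translating the cube: `y = x ⊕ a`
  have himage : (univ.filter fun y : Fin (6 + 6) → Bool => (∀ l, l ∉ J → y l = decide (l ∈ A)) ∧ κ y = true) =
      (univ.filter fun x : Fin (6 + 6) → Bool => (∀ i, x i = true → i ∈ J) ∧ κ (bxor x a) = true).image (fun x => bxor x a) := by
    ext y
    simp only [mem_filter, mem_univ, true_and, mem_image]
    constructor
    · rintro ⟨hy, hκy⟩
      refine ⟨bxor y a, ⟨fun i hi => ?_, ?_⟩, ?_⟩
      · by_contra hiJ
        have h1 := hy i hiJ
        have : (bxor y a) i = false := by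
          show (y i ^^ a i) = false
          rw [h1, ha]
          by_cases hiA : i ∈ A <;> simp [hiA, hiJ]
        rw [this] at hi
        exact Bool.false_ne_true hi
      · have : bxor (bxor y a) a = y := by funext i; show ((y i ^^ a i) ^^ a i) = y i; cases y i <;> cases a i <;> rfl
        rw [this]; exact hκy
      · funext i; show ((y i ^^ a i) ^^ a i) = y i; cases y i <;> cases a i <;> rfl
    · rintro ⟨x, ⟨hx, hκx⟩, rfl⟩
      refine ⟨fun l hl => ?_, hκx⟩
      show (x l ^^ a l) = decide (l ∈ A)
      have hxl : x l = false := by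
        cases h : x l
        · rfl
        · exact absurd (hx l h) hl
      rw [hxl, ha]
      by_cases hlA : l ∈ A <;> simp [hlA, hl]
  have hinj : Function.Injective (fun x : Fin (6 + 6) → Bool => bxor x a) := by
    intro x y hxy
    have h := congrArg (fun z : Fin (6 + 6) → Bool => bxor z a) hxy
    have ex : bxor (bxor x a) a = x := by funext i; show ((x i ^^ a i) ^^ a i) = x i; cases x i <;> cases a i <;> rfl
    have ey : bxor (bxor y a) a = y := by funext i; show ((y i ^^ a i) ^^ a i) = y i; cases y i <;> cases a i <;> rfl
    simp only [ex, ey] at h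
    exact h
  rw [himage, card_image_of_injective _ hinj]
  -- `κ(x ⊕ a) = κ x ⊕ D x` with `D` quadratic
  have hD : IsDegLeFun 2 (fun x => κ x ^^ κ (bxor x a)) := stub_derivDegree (6 + 6) 2 κ a hκ
  have hrew : (univ.filter fun x : Fin (6 + 6) → Bool => (∀ i, x i = true → i ∈ J) ∧ κ (bxor x a) = true) =
      ({x : Fin (6 + 6) → Bool | ∀ i, x i = true → i ∈ J} : Finset _).filter
        fun x => (κ x ^^ (κ x ^^ κ (bxor x a))) = true := by
    rw [filter_filter]
    refine filter_congr fun x _ => ?_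
    cases κ x <;> cases κ (bxor x a) <;> simp
  rw [hrew, tdn_card_bxor_mod2]
  -- the quadratic derivative is even on the `3`-cube
  obtain ⟨z, hz⟩ := stub_axParity (6 + 6) 2 (fun x => κ x ^^ κ (bxor x a)) J (by norm_num) hD
  have hexp : (#J + 2 - 1) / 2 = 2 := by rw [hJ]
  rw [hexp, bb_sum_signOf] at hz
  have hcardR : ((#({x : Fin (6 + 6) → Bool | ∀ i, x i = true → i ∈ J} : Finset _) : ℕ) : ℝ) = 8 := by
    rw [bb_card_cube J, hJ]; norm_num
  rw [hcardR] at hz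
  have hDz : (8 : ℤ) - 2 * (#(univ.filter fun x : Fin (6 + 6) → Bool =>
      (∀ i, x i = true → i ∈ J) ∧ (κ x ^^ κ (bxor x a)) = true) : ℤ) = 2 ^ 2 * z := by
    have h' : ((8 : ℤ) : ℝ) - 2 * ((#(univ.filter fun x : Fin (6 + 6) → Bool =>
        (∀ i, x i = true → i ∈ J) ∧ (κ x ^^ κ (bxor x a)) = true) : ℤ) : ℝ) = (((2 : ℤ) ^ 2 * z : ℤ) : ℝ) := by
      push_cast; linarith
    exact_mod_cast h'
  rw [filter_filter, filter_filter]
  omega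

/-- Splitting a translate of a `3`-cube along a free coordinate `i ∉ I ∪ J` into two translates of the `2`-cube `E_J`. -/
theorem tdn_flat_split (I J : Finset (Fin (6 + 6))) (i : Fin (6 + 6)) (hiI : i ∉ I) (hiJ : i ∉ J) (y : Fin (6 + 6) → Bool) :
    (∀ l, l ∉ insert i J → y l = decide (l ∈ I)) ↔
      ((∀ l, l ∉ J → y l = decide (l ∈ I)) ∨ (∀ l, l ∉ J → y l = decide (l ∈ insert i I))) := by
  constructor
  · intro h
    cases hyi : y i
    · left
      intro l hl
      by_cases hli : l = i
      · subst hli; rw [hyi]; simp [hiI]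
      · exact h l (by rw [mem_insert]; push Not; exact ⟨hli, hl⟩)
    · right
      intro l hl
      by_cases hli : l = i
      · subst hli; rw [hyi]; simp
      · rw [h l (by rw [mem_insert]; push Not; exact ⟨hli, hl⟩)]
        simp [hli]
  · rintro (h | h)
    · intro l hl
      rw [mem_insert] at hl; push Not at hl
      exact h l hl.2
    · intro l hl
      rw [mem_insert] at hl; push Not at hl
      rw [h l hl.2]
      simp [hl.1]

/-- **The ANF of a derivative on a `2`-cube.**  For cubic `κ`, `|J| = 2` and `I` disjoint from `J`:
`#{y ∈ 1_I ⊕ E_J : κ y} ≡ #{E_J ∩ κ} + Σ_{i ∈ I} #{E_{J ∪ {i}} ∩ κ} (mod 2)` (induction on `I`, each step a `3`-cube split into two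
`2`-cube translates + `tdn_flat3_parity`). [this work] -/
theorem tdn_flat2_count (hκ : IsDegLeFun 3 κ) (J : Finset (Fin (6 + 6))) (hJ : #J = 2) (I : Finset (Fin (6 + 6)))
    (hIJ : Disjoint I J) :
    (#(univ.filter fun y : Fin (6 + 6) → Bool => (∀ l, l ∉ J → y l = decide (l ∈ I)) ∧ κ y = true) : ℤ) % 2 =
      ((#(univ.filter fun x : Fin (6 + 6) → Bool => (∀ i, x i = true → i ∈ J) ∧ κ x = true) : ℤ) +
        ∑ i ∈ I, (#(univ.filter fun x : Fin (6 + 6) → Bool => (∀ l, x l = true → l ∈ insert i J) ∧ κ x = true) : ℤ)) % 2 := by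
  induction I using Finset.induction_on with
  | empty =>
    rw [sum_empty, add_zero]
    have hset : (univ.filter fun y : Fin (6 + 6) → Bool =>
        (∀ l, l ∉ J → y l = decide (l ∈ (∅ : Finset (Fin (6 + 6))))) ∧ κ y = true) =
        univ.filter fun x : Fin (6 + 6) → Bool => (∀ i, x i = true → i ∈ J) ∧ κ x = true :=
      filter_congr fun y _ => by rw [tdn_flat_empty]
    rw [hset]
  | insert i I hiI ih =>
    have hiJ : i ∉ J := fun h => (disjoint_left.1 hIJ (mem_insert_self i I)) h
    have hIJ' : Disjoint I J := disjoint_of_subset_left (subset_insert i I) hIJ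
    have ih' := ih hIJ'
    -- the `3`-cube translate `1_I ⊕ E_{J ∪ {i}}` splits
    have hsplit : (univ.filter fun y : Fin (6 + 6) → Bool => (∀ l, l ∉ insert i J → y l = decide (l ∈ I)) ∧ κ y = true) =
        (univ.filter fun y : Fin (6 + 6) → Bool => (∀ l, l ∉ J → y l = decide (l ∈ I)) ∧ κ y = true) ∪
          (univ.filter fun y : Fin (6 + 6) → Bool => (∀ l, l ∉ J → y l = decide (l ∈ insert i I)) ∧ κ y = true) := by
      rw [← filter_or]
      refine filter_congr fun y _ => ?_
      rw [tdn_flat_split I J i hiI hiJ y, or_and_right]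
    have hdisj : Disjoint (univ.filter fun y : Fin (6 + 6) → Bool => (∀ l, l ∉ J → y l = decide (l ∈ I)) ∧ κ y = true)
        (univ.filter fun y : Fin (6 + 6) → Bool => (∀ l, l ∉ J → y l = decide (l ∈ insert i I)) ∧ κ y = true) := by
      rw [disjoint_filter]
      rintro y - ⟨h1, -⟩ ⟨h2, -⟩
      have a1 := h1 i hiJ
      have a2 := h2 i hiJ
      rw [a1] at a2
      simp [hiI] at a2
    have h3 := tdn_flat3_parity κ hκ (insert i J) (by rw [card_insert_of_notMem hiJ, hJ]) I
    rw [hsplit, card_union_of_disjoint hdisj, Nat.cast_add] at h3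
    rw [sum_insert hiI]
    omega

end Flats

end Summit.QuantumAdvantage.QuantumAdvantage.Theorems.CubicForrelation.NearExactIsExact

end
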